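import Literature.RepresentationTheory.Kovacevic2021.SU21KTypeMultiplicity
import Literature.RepresentationTheory.Kovacevic2021.SU21Casimir
import Literature.Algebra.Lie.ChevalleyEilenbergCasimirHomotopy
import HarnessLib

/-!
# The Casimir of Kovačević's `SU(2,1)`-modules is central; reduced eigenvalue; lowest `K`-types
# (add-on to `SU21KTypeMultiplicity` / `SU21Casimir`)

Add-on (cell `pub-hodgecm2`, row D10-2; re-filed deduplicated content of the bounced p244384 per its
review) to `Literature.RepresentationTheory.Kovacevic2021.SU21KTypeMultiplicity` (the `K`-type
decomposition `V = ⊕ V_{n,m}`) and `…SU21Casimir` (the Casimir operator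
`SU21Datum.casimir = ∑_{i,j} ρ(E_{ij}) ρ(E_{ji})`, `casimir_vec : C u^k_{n,m} = casimirScalar n m • u^k_{n,m}`,
`C = 0` on the six cohomological data).  Nothing of those files is restated; added here:
* §0 (general: commutative ring `R`, finite `ι`, associative `R`-algebra `A`): for a Lie algebra
  homomorphism `ρ : 𝔤𝔩(ι, R) → A` the image `C_ρ = ∑_{i,j} ρ(E_{ij}) ρ(E_{ji})` of the Casimir element of
  the trace form commutes with `ρ(𝔤𝔩(ι, R))` — Humphreys' Lemma "`c_φ(β)` commutes with `φ(L)`"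
  [Humphreys1972, §6.2] for the dual bases of matrix units (`lieHom_matrix_comm_casimirSum`);
* §1 hence `SU21Datum.casimir` commutes with the action (`casimir_comm`, `casimir_lie`) and is the
  tree's `Literature.Algebra.Lie.ChevalleyEilenberg.casimirOp` for `σ = ρ` and the canonical tensor
  `∑ E_{ij} ⊗ E_{ji}` (`casimir_eq_casimirOp`; the shape of BW II 3.1 / `d_casimirHomotopy_add`);
* §2 the eigenvalue REDUCED by the relations (b20), (b25) of [Kovacevic2021, Thm 2]:
  `C u^k_{n,m} = ((n−1)(n+3)/2 + m²/6 + 2n (A_{n,m}D_{n+1,m+3} + B_{n,m}C_{n+1,m−3})) u^k_{n,m}`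
  (`casimir_vec_reduced`: only the gauge-invariant products `AD'`, `BC'` of [Kovacevic2021, Remark 3]
  enter), `casimir_eq_smul_one`, and the CLOSED FORM on the ray data: `C = ((e² − 9)/6) · 1` on
  `rayNE e n₀` / `raySE e n₀` (`casimir_rayNE_eq_smul`, `casimir_raySE_eq_smul`) — so `C ≠ 0` for
  `e² ≠ 9` (`casimir_rayNE_ne_zero`; by [BorelWallach2000, II Cor. 3.3] such modules, e.g. Kovačević's
  `U(0,2t)` with `t² ≠ 9`, have no `(𝔤, K)`-cohomology);
* §3 `disjoint_Ktype` and the lowest-`K`-type label tables behind BW VI 4.10 (3) / 4.11 (9) at `n = 2`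
  (`fLabels_*`: with the dictionary `F_{0,0} = V_{1,0}`, `F_{1,0} = V_{2,3}`, `F_{0,1} = V_{2,−3}`,
  `F_{2,0} = V_{1,6}`, `F_{1,1} = V_{3,0}`, `F_{0,2} = V_{1,−6}`, each of the six data contains exactly one
  of the six `F_{p,q}`).

References: J. E. Humphreys (1972) §6.2 [Humphreys1972]; A. Borel, N. Wallach (2000) II §2.3–2.5,
Cor. 3.3, VI 4.8–4.11 [BorelWallach2000]; D. Kovačević (2021) §3 Thm 2, Thm 3, Remark 3, §4
[Kovacevic2021].
-/

noncomputable section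

namespace Literature.RepresentationTheory.Kovacevic2021

-- Mathlib idiom (Mathlib/Algebra/Lie/OfAssociative.lean): commutator brackets on associative algebras.
attribute [local instance 100] LieRing.ofAssociativeRing

/-! ## §0 The Casimir of `𝔤𝔩(ι, R)` under a Lie algebra homomorphism is central -/

section MatrixCasimir

variable {R : Type*} [CommRing R] {A : Type*} [Ring A] [Algebra R A]
  {ι : Type*} [Fintype ι] [DecidableEq ι]

/-- The commutator of two matrix units: `[E_{ab}, E_{ij}] = δ_{bi} E_{aj} − δ_{ja} E_{ib}`. [folklore] -/
private theorem single_one_commutator (a b i j : ι) :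
    Matrix.single a b (1 : R) * Matrix.single i j 1 - Matrix.single i j 1 * Matrix.single a b 1 =
      (if b = i then Matrix.single a j 1 else 0) - (if j = a then Matrix.single i b 1 else 0) := by
  congr 1
  · split_ifs with h
    · subst h; rw [Matrix.single_mul_single_same, mul_one]
    · simp [Matrix.single_mul_single_of_ne, h]
  · split_ifs with h
    · subst h; rw [Matrix.single_mul_single_same, mul_one]
    · simp [Matrix.single_mul_single_of_ne, h]

/-- **The image of the Casimir element is central.** For a Lie algebra homomorphism
`ρ : 𝔤𝔩(ι, R) → A` into an associative algebra (commutator bracket), the element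
`C_ρ = ∑_{i,j} ρ(E_{ij}) ρ(E_{ji})` — the image of the Casimir element of the invariant form `tr(XY)`,
whose dual bases are `{E_{ij}}` and `{E_{ji}}` — commutes with every `ρ(M)`.
This is Humphreys' Lemma "`c_φ(β)` commutes with `φ(L)`" (§6.2, for the trace form `β` of `𝔤𝔩(ι)` and
its dual bases of matrix units), transported along `ρ`; proved by the direct computation `[ρ(E_{ab}), C_ρ] = 0`.
[cite: Humphreys1972, §6.2 Lemma (p. 27)] -/
theorem lieHom_matrix_comm_casimirSum (ρ : Matrix ι ι R →ₗ⁅R⁆ A) (M : Matrix ι ι R) :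
    ρ M * (∑ i, ∑ j, ρ (Matrix.single i j 1) * ρ (Matrix.single j i 1)) =
      (∑ i, ∑ j, ρ (Matrix.single i j 1) * ρ (Matrix.single j i 1)) * ρ M := by
  set C := ∑ i, ∑ j, ρ (Matrix.single i j 1) * ρ (Matrix.single j i 1) with hC
  -- reduction to matrix units
  suffices h : ∀ a b : ι, ρ (Matrix.single a b 1) * C = C * ρ (Matrix.single a b 1) by
    have hM : ρ M = ∑ a, ∑ b, M a b • ρ (Matrix.single a b 1) := by
      conv_lhs => rw [Matrix.matrix_eq_sum_single M]
      simp only [map_sum]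
      refine Finset.sum_congr rfl fun a _ => Finset.sum_congr rfl fun b _ => ?_
      rw [← map_smul, Matrix.smul_single, smul_eq_mul, mul_one]
    rw [hM, Finset.sum_mul, Finset.mul_sum]
    refine Finset.sum_congr rfl fun a _ => ?_
    rw [Finset.sum_mul, Finset.mul_sum]
    refine Finset.sum_congr rfl fun b _ => ?_
    rw [smul_mul_assoc, mul_smul_comm, h a b]
  intro a b
  rw [← sub_eq_zero]
  -- `[x, ∑ y z] = ∑ ([x, y] z + y [x, z])`
  have expand : ρ (Matrix.single a b 1) * C - C * ρ (Matrix.single a b 1) =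
      ∑ i, ∑ j, ((ρ (Matrix.single a b 1) * ρ (Matrix.single i j 1)
          - ρ (Matrix.single i j 1) * ρ (Matrix.single a b 1)) * ρ (Matrix.single j i 1)
        + ρ (Matrix.single i j 1) * (ρ (Matrix.single a b 1) * ρ (Matrix.single j i 1)
          - ρ (Matrix.single j i 1) * ρ (Matrix.single a b 1))) := by
    rw [hC, Finset.mul_sum, Finset.sum_mul, ← Finset.sum_sub_distrib]
    refine Finset.sum_congr rfl fun i _ => ?_
    rw [Finset.mul_sum, Finset.sum_mul, ← Finset.sum_sub_distrib]
    refine Finset.sum_congr rfl fun j _ => ?_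
    noncomm_ring
  -- the brackets are images of matrix commutators
  have br : ∀ i j : ι, ρ (Matrix.single a b 1) * ρ (Matrix.single i j 1)
      - ρ (Matrix.single i j 1) * ρ (Matrix.single a b 1) =
      (if b = i then ρ (Matrix.single a j 1) else 0) - (if j = a then ρ (Matrix.single i b 1) else 0) := by
    intro i j
    rw [← LieRing.of_associative_ring_bracket, ← LieHom.map_lie, LieRing.of_associative_ring_bracket,
      single_one_commutator, map_sub]
    congr 1 <;> split_ifs <;> simp
  rw [expand]
  simp only [br, sub_mul, mul_sub, ite_mul, zero_mul, mul_ite, mul_zero, Finset.sum_add_distrib,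
    Finset.sum_sub_distrib, Finset.sum_ite_irrel, Finset.sum_const_zero, Finset.sum_ite_eq,
    Finset.sum_ite_eq', Finset.mem_univ, if_true]
  abel

end MatrixCasimir

namespace SU21Datum

variable (𝒟 : SU21Datum)

/-! ## §1 `SU21Datum.casimir` is a module endomorphism and is the tree's `casimirOp` -/

/-- `C` commutes with the action of `𝔤𝔩(3,ℂ)`. [cite: BorelWallach2000, II §2.3 p. 34] -/
theorem casimir_comm (M : Matrix (Fin 3) (Fin 3) ℂ) : 𝒟.ρfun M * 𝒟.casimir = 𝒟.casimir * 𝒟.ρfun M :=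
  lieHom_matrix_comm_casimirSum 𝒟.ρ M

/-- `C` is an endomorphism of the `𝔤𝔩(3,ℂ)`-module `V`: `C ⁅M, v⁆ = ⁅M, C v⁆`. [cite: BorelWallach2000, II §2.3 p. 34] -/
theorem casimir_lie (M : Matrix (Fin 3) (Fin 3) ℂ) (v : 𝒟.V) : 𝒟.casimir ⁅M, v⁆ = ⁅M, 𝒟.casimir v⁆ := by
  rw [lie_def, lie_def, ← Module.End.mul_apply, ← casimir_comm, Module.End.mul_apply]

/-- `C` is the tree's Casimir-type operator `casimirOp σ y y' = ∑_s σ(y_s) ρ(y'_s)` for `σ = ρ` and the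
canonical tensor `∑_{(i,j)} E_{ij} ⊗ E_{ji}` of the trace form (the shape consumed by
`Literature.Algebra.Lie.ChevalleyEilenberg.d_casimirHomotopy_add` / BW II 3.1).
[cite: BorelWallach2000, II §2.3–2.5 pp. 34–36] -/
theorem casimir_eq_casimirOp :
    𝒟.casimir = Literature.Algebra.Lie.ChevalleyEilenberg.casimirOp
      ((LieModule.toEnd ℂ (Matrix (Fin 3) (Fin 3) ℂ) 𝒟.V : Matrix (Fin 3) (Fin 3) ℂ →ₗ⁅ℂ⁆ _) :
        Matrix (Fin 3) (Fin 3) ℂ →ₗ[ℂ] Module.End ℂ 𝒟.V)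
      (fun p : Fin 3 × Fin 3 => E p.1 p.2) (fun p => E p.2 p.1) := by
  rw [Literature.Algebra.Lie.ChevalleyEilenberg.casimirOp, casimir, ← Finset.sum_product']
  rfl

/-! ## §2 The reduced eigenvalue and the closed form on the ray data -/

/-- **The Casimir eigenvalue reduced by (b20), (b25)**: for every label,
`C u^k_{n,m} = ((n−1)(n+3)/2 + m²/6 + 2n (A_{n,m} D_{n+1,m+3} + B_{n,m} C_{n+1,m−3})) u^k_{n,m}`; only the
gauge-invariant products `A D'`, `B C'` enter (from `casimir_vec` and the raw `casimirScalar` of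
`SU21Casimir` by `rel25 − rel20`). [cite: Kovacevic2021, §3 Thm 2, Remark 3] -/
theorem casimir_vec_reduced (n m k : ℤ) :
    𝒟.casimir (𝒟.vec n m k) =
      ((((n : ℂ) - 1) * ((n : ℂ) + 3) / 2 + (m : ℂ) ^ 2 / 6
        + 2 * (n : ℂ) * (𝒟.A n m * 𝒟.D (n + 1) (m + 3) + 𝒟.B n m * 𝒟.C (n + 1) (m - 3))))
        • 𝒟.vec n m k := by
  by_cases h : (n, m) ∈ 𝒟.S ∧ 1 ≤ k ∧ k ≤ n
  · rw [𝒟.casimir_vec h.1 h.2.1 h.2.2, casimirScalar]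
    congr 1
    linear_combination 𝒟.rel25 h.1 - 𝒟.rel20 h.1
  · rw [vec_of_neg n m k h, map_zero, smul_zero]

/-- A datum on all of whose `K`-types the reduced eigenvalue equals `c` has `C = c · 1`.
[cite: Kovacevic2021, §3 Thm 2, Remark 3] -/
theorem casimir_eq_smul_one {c : ℂ}
    (h : ∀ n m : ℤ, (n, m) ∈ 𝒟.S →
      ((n : ℂ) - 1) * ((n : ℂ) + 3) / 2 + (m : ℂ) ^ 2 / 6
        + 2 * (n : ℂ) * (𝒟.A n m * 𝒟.D (n + 1) (m + 3) + 𝒟.B n m * 𝒟.C (n + 1) (m - 3)) = c) :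
    𝒟.casimir = c • (1 : Module.End ℂ 𝒟.V) := by
  refine ext_vec fun n m k hS hk hkn => ?_
  rw [casimir_vec_reduced, h n m hS, LinearMap.smul_apply, Module.End.one_apply]

variable {𝒟}

/-- **Closed form on the north-east ray datum**: `C = ((e² − 9)/6) · 1` on `rayNE e n₀` (`K`-types
`V_{n,3n+e}`, `n ≥ n₀`; with the reduced eigenvalue no case distinction at the bottom `K`-type is needed).
[cite: Kovacevic2021, §3 Thm 3 (b75), §4] -/
theorem casimir_rayNE_eq_smul (e n₀ : ℤ) (h₀ : 1 ≤ n₀) (h : 2 * n₀ ^ 2 + (e - 3) * n₀ + (1 - e) = 0) :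
    (rayNE e n₀ h₀ h).casimir = (((e : ℂ) ^ 2 - 9) / 6) • (1 : Module.End ℂ (rayNE e n₀ h₀ h).V) := by
  refine casimir_eq_smul_one _ fun n m hS => ?_
  obtain ⟨hn, hm⟩ := hS
  change n₀ ≤ n at hn
  change m = 3 * n + e at hm
  subst hm
  have hA : (rayNE e n₀ h₀ h).A n (3 * n + e) = -(2 * (n : ℂ) + e + 1) / 2 := if_pos ⟨hn, rfl⟩
  have hD : (rayNE e n₀ h₀ h).D (n + 1) (3 * n + e + 3) = 1 := if_pos ⟨by omega, by ring⟩
  have hB : (rayNE e n₀ h₀ h).B n (3 * n + e) = 0 := rfl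
  rw [hA, hD, hB]
  push_cast
  ring

/-- **Closed form on the south-east ray datum**: `C = ((e² − 9)/6) · 1` on `raySE e n₀`.
[cite: Kovacevic2021, §3 Thm 3 (b80), §4] -/
theorem casimir_raySE_eq_smul (e n₀ : ℤ) (h₀ : 1 ≤ n₀) (h : 2 * n₀ ^ 2 + (e - 3) * n₀ + (1 - e) = 0) :
    (raySE e n₀ h₀ h).casimir = (((e : ℂ) ^ 2 - 9) / 6) • (1 : Module.End ℂ (raySE e n₀ h₀ h).V) := by
  refine casimir_eq_smul_one _ fun n m hS => ?_
  obtain ⟨hn, hm⟩ := hS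
  change n₀ ≤ n at hn
  change m = -(3 * n + e) at hm
  subst hm
  have hB : (raySE e n₀ h₀ h).B n (-(3 * n + e)) = -(2 * (n : ℂ) + e + 1) / 2 := if_pos ⟨hn, rfl⟩
  have hC : (raySE e n₀ h₀ h).C (n + 1) (-(3 * n + e) - 3) = 1 := if_pos ⟨by omega, by ring⟩
  have hA : (raySE e n₀ h₀ h).A n (-(3 * n + e)) = 0 := rfl
  rw [hA, hB, hC]
  push_cast
  ring

/-- **`C ≠ 0` off `e² = 9`**: on a ray datum `rayNE e n₀` with `e² ≠ 9` the Casimir is a non-zero scalar —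
in contrast with `casimir_rayNE … (he : e ^ 2 = 9)` of `SU21Casimir`; by BW II Cor. 3.3 such modules have
no `(𝔤, K)`-cohomology. [cite: BorelWallach2000, II Cor. 3.3 p. 37] -/
theorem casimir_rayNE_ne_zero (e n₀ : ℤ) (h₀ : 1 ≤ n₀) (h : 2 * n₀ ^ 2 + (e - 3) * n₀ + (1 - e) = 0)
    (he : e ^ 2 ≠ 9) : (rayNE e n₀ h₀ h).casimir ≠ 0 := by
  rw [casimir_rayNE_eq_smul]
  intro h0
  have hv : (rayNE e n₀ h₀ h).vec n₀ (3 * n₀ + e) 1 ≠ 0 := vec_ne_zero ⟨⟨le_rfl, rfl⟩, le_rfl, h₀⟩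
  have := LinearMap.congr_fun h0 ((rayNE e n₀ h₀ h).vec n₀ (3 * n₀ + e) 1)
  rw [LinearMap.smul_apply, Module.End.one_apply, LinearMap.zero_apply, smul_eq_zero] at this
  rcases this with hc | hv0
  · have h9 : (e : ℂ) ^ 2 - 9 = 0 := by
      rcases div_eq_zero_iff.1 hc with h' | h' <;> [exact h'; norm_num at h']
    exact he (by exact_mod_cast (sub_eq_zero.1 h9))
  · exact hv hv0

variable (𝒟)

/-! ## §3 Distinct labels, and the lowest-`K`-type tables behind BW VI 4.10 (3) / 4.11 (9) at `n = 2`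

With night 1's dictionary `F_{0,0} = V_{1,0}`, `F_{1,0} = V_{2,3}`, `F_{0,1} = V_{2,−3}`, `F_{2,0} = V_{1,6}`,
`F_{1,1} = V_{3,0}`, `F_{0,2} = V_{1,−6}` (the irreducible constituents `F_{p,q} ⊂ Λ^p 𝔭⁺ ⊗ Λ^q 𝔭⁻` of BW
VI 4.9 for `n = 2`), BW VI 4.10 (3) / 4.11 (9) say that each of the six modules contains exactly one of the
six `F_{p,q}`; by `Ktype_ne_bot_iff` (night 1) "`V` contains the `K`-type `V_{a,b}`" is `(a,b) ∈ S`. -/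

/-- Distinct labels give disjoint `K`-types (from `iSupIndep_Ktype` of `SU21KTypeMultiplicity`).
[cite: Kovacevic2021, §3 Def 1] -/
theorem disjoint_Ktype {p q : ℤ × ℤ} (hpq : p ≠ q) : Disjoint (𝒟.Ktype p.1 p.2) (𝒟.Ktype q.1 q.2) :=
  𝒟.iSupIndep_Ktype.pairwiseDisjoint hpq

/-- `D₂ = U(0,6)` contains `F_{2,0} = V_{1,6}` and none of the other five `F_{p,q}`. [cite: BorelWallach2000, VI 4.10 (3) p. 132] -/
theorem fLabels_holDS : ((1 : ℤ), (6 : ℤ)) ∈ holDS.S ∧ ((1 : ℤ), (0 : ℤ)) ∉ holDS.S ∧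
    ((2 : ℤ), (3 : ℤ)) ∉ holDS.S ∧ ((2 : ℤ), (-3 : ℤ)) ∉ holDS.S ∧ ((3 : ℤ), (0 : ℤ)) ∉ holDS.S ∧
    ((1 : ℤ), (-6 : ℤ)) ∉ holDS.S := by
  simp only [mem_holDS]; omega

/-- `D₀ = U(0,−6)` contains `F_{0,2} = V_{1,−6}` and none of the other five `F_{p,q}`. [cite: BorelWallach2000, VI 4.10 (3) p. 132] -/
theorem fLabels_antiholDS : ((1 : ℤ), (-6 : ℤ)) ∈ antiholDS.S ∧ ((1 : ℤ), (0 : ℤ)) ∉ antiholDS.S ∧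
    ((2 : ℤ), (3 : ℤ)) ∉ antiholDS.S ∧ ((2 : ℤ), (-3 : ℤ)) ∉ antiholDS.S ∧ ((3 : ℤ), (0 : ℤ)) ∉ antiholDS.S ∧
    ((1 : ℤ), (6 : ℤ)) ∉ antiholDS.S := by
  simp only [mem_antiholDS]; omega

/-- `J_{1,0} = Z(3)` contains `F_{1,0} = V_{2,3}` and none of the other five `F_{p,q}`. [cite: BorelWallach2000, VI Thm 4.11 (9) p. 133] -/
theorem fLabels_ladderPlus : ((2 : ℤ), (3 : ℤ)) ∈ ladderPlus.S ∧ ((1 : ℤ), (0 : ℤ)) ∉ ladderPlus.S ∧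
    ((2 : ℤ), (-3 : ℤ)) ∉ ladderPlus.S ∧ ((1 : ℤ), (6 : ℤ)) ∉ ladderPlus.S ∧ ((3 : ℤ), (0 : ℤ)) ∉ ladderPlus.S ∧
    ((1 : ℤ), (-6 : ℤ)) ∉ ladderPlus.S := by
  simp only [mem_ladderPlus]; omega

/-- `J_{0,1} = Z(−3)` contains `F_{0,1} = V_{2,−3}` and none of the other five `F_{p,q}`. [cite: BorelWallach2000, VI Thm 4.11 (9) p. 133] -/
theorem fLabels_ladderMinus : ((2 : ℤ), (-3 : ℤ)) ∈ ladderMinus.S ∧ ((1 : ℤ), (0 : ℤ)) ∉ ladderMinus.S ∧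
    ((2 : ℤ), (3 : ℤ)) ∉ ladderMinus.S ∧ ((1 : ℤ), (6 : ℤ)) ∉ ladderMinus.S ∧ ((3 : ℤ), (0 : ℤ)) ∉ ladderMinus.S ∧
    ((1 : ℤ), (-6 : ℤ)) ∉ ladderMinus.S := by
  simp only [mem_ladderMinus]; omega

/-- `J_{0,0} = U(0)` contains `F_{0,0} = V_{1,0}` and none of the other five `F_{p,q}`. [cite: BorelWallach2000, VI Thm 4.11 (9) p. 133] -/
theorem fLabels_trivialMod : ((1 : ℤ), (0 : ℤ)) ∈ trivialMod.S ∧ ((2 : ℤ), (3 : ℤ)) ∉ trivialMod.S ∧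
    ((2 : ℤ), (-3 : ℤ)) ∉ trivialMod.S ∧ ((1 : ℤ), (6 : ℤ)) ∉ trivialMod.S ∧ ((3 : ℤ), (0 : ℤ)) ∉ trivialMod.S ∧
    ((1 : ℤ), (-6 : ℤ)) ∉ trivialMod.S := by
  simp [trivialMod]

/-- `D₁ = W(3,0)` contains `F_{1,1} = V_{3,0}` and none of the other five `F_{p,q}`. [cite: BorelWallach2000, VI 4.10 (3) p. 132] -/
theorem fLabels_midDS : ((3 : ℤ), (0 : ℤ)) ∈ midDS.S ∧ ((1 : ℤ), (0 : ℤ)) ∉ midDS.S ∧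
    ((2 : ℤ), (3 : ℤ)) ∉ midDS.S ∧ ((2 : ℤ), (-3 : ℤ)) ∉ midDS.S ∧ ((1 : ℤ), (6 : ℤ)) ∉ midDS.S ∧
    ((1 : ℤ), (-6 : ℤ)) ∉ midDS.S := by
  simp only [mem_midDS]
  refine ⟨⟨0, 0, by norm_num, by norm_num⟩, ?_, ?_, ?_, ?_, ?_⟩ <;> rintro ⟨p, q, hn, hm⟩ <;> omega

end SU21Datum

end Literature.RepresentationTheory.Kovacevic2021
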